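import Summits.RiemannHypothesis.RiemannHypothesis.Theorems.PfPersistenceMarkovCoreConvergence
import Summits.RiemannHypothesis.RiemannHypothesis.Theorems.PfPersistenceMarkovCoreDialLaw
import HarnessLib

/-!
# PF persistence (theory 1, edge law): THE MARKOV CORE OF A NON-NEGATIVE WEIGHT TABLE, X —
# stability of the core ground state under table perturbation

Helper file (`--supports stmt-RiemannHypothesis-19953`); mechanism/rigidity campaign; no RH claims.
Tenth file of the chain `PfPersistenceMarkovCore*`.  Files I–VIII give kernel Perron–Frobenius for
the Markov core of every table `w ≥ 0` on the prime index of the window and the convergence of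
minimising sequences; file IX gives the dial law of the bottom (`coreBottom` is 4-Lipschitz for
`tableDist`).  This file proves that the CORE GROUND STATE itself depends CONTINUOUSLY on the table:

* `IsCoreGround.exists_isWeilTest_near` — a core ground state is approximated in `L²` AND in energy
  by normalised window test functions (minimising test sequences exist by `coreBottom_eq_sInf_isWeilTest`
  and converge to the ground state modulo phases by file VIII);
* `IsCoreGround.tendsto_of_tables` — if `tableDist a w_k w → 0` (non-negative tables) and `u_k`, `u`
  are core ground states of `w_k`, `w` on the window, then `u_k → u` in `L²` MODULO UNIMODULAR CONSTANTS
  (the test approximants of `u_k` form a minimising sequence for `w` by the Lipschitz law, file VIII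
  applies, and the triangle inequality transfers the convergence back to `u_k`);
* `tendsto_of_tables_of_nonneg` — for the a.e. NON-NEGATIVE representatives (which exist and are
  unique, files IV/VII) the constants are forced to `1`: `Φ_{w_k} → Φ_w` in `L²` outright;
* `tendsto_coreBottom_of_tables` — the bottom is continuous along the way (file IX).

All of it RH-free, operator-free, for EVERY window `a > 0` and the WHOLE non-negative-table class —
structure of the class (twin-blind: everything depends on the table only through its values on
`weilPrimeIndex a`), never a ζ-specific statement.

## References

* E. Bombieri, Rend. Mat. Acc. Lincei (9) 11 (2000) 183–233, §4 Thm 3 (minimising sequences).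
* M. Reed, B. Simon, *Methods of Modern Mathematical Physics IV* (1978), §XIII.12 (non-degenerate
  ground states; continuity of isolated simple eigenvectors is the operator-theoretic analogue — here
  replaced by the variational argument, no spectral gap needed).
* E. H. Lieb, M. Loss, *Analysis*, 2nd ed. (2001), §11 (minimising sequences and their limits).
-/

set_option linter.dupNamespace false

noncomputable section

open MeasureTheory Set Filter
open scoped Topology ENNReal NNReal ComplexConjugate

namespace Summit.RiemannHypothesis.RiemannHypothesis.Theorems.PfPersistence

open Literature.NumberTheory.LFunctions Literature.NumberTheory.LFunctions.ConnesVanSuijlekom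
open Summit.RiemannHypothesis.RiemannHypothesis.Theorems.WeilGroundStateMarkovPart

variable {a : ℝ} {w : ℕ → ℝ}

/-! ## §1 Test-function approximants of a core ground state -/

/-- **A core ground state is `L²`- and energy-approximated by normalised window tests**: for every
`ε > 0` there is a window test function `g` (`IsWeilTest`, `tsupport g ⊆ [-a, a]`, `‖g‖₂ = 1`) with
`𝓔^w_a(g) ≤ coreBottom w a + ε` and `∫ |g − u|² ≤ ε`. [cite: Bombieri2000Weil, §4 Thm 3] -/
theorem IsCoreGround.exists_isWeilTest_near (hw : ∀ n ∈ weilPrimeIndex a, 0 ≤ w n) (ha : 0 < a)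
    {u : ℝ → ℂ} (hu : IsCoreGround w a u) {ε : ℝ} (hε : 0 < ε) :
    ∃ g : ℝ → ℂ, IsWeilTest g ∧ tsupport g ⊆ Icc (-a) a ∧ ∫ t, ‖g t‖ ^ 2 = (1 : ℝ) ∧
      tableDirichletEnergy a w g ≤ coreBottom w a + ε ∧ ∫ x, ‖g x - u x‖ ^ 2 ≤ ε := by
  classical
  -- a minimising sequence of normalised window tests
  set T : Set ℝ := {x : ℝ | ∃ h : ℝ → ℂ, IsWeilTest h ∧ tsupport h ⊆ Icc (-a) a ∧
      ∫ t, ‖h t‖ ^ 2 = (1 : ℝ) ∧ x = tableDirichletEnergy a w h} with hTdef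
  have hT : coreBottom w a = sInf T := coreBottom_eq_sInf_isWeilTest hw ha
  have hTne : T.Nonempty := by
    obtain ⟨g, hg, hgs, hn⟩ := exists_isWeilTest_sphere ha
    exact ⟨_, g, hg, hgs, hn, rfl⟩
  have hstep : ∀ j : ℕ, ∃ h : ℝ → ℂ, IsWeilTest h ∧ tsupport h ⊆ Icc (-a) a ∧
      ∫ t, ‖h t‖ ^ 2 = (1 : ℝ) ∧
        tableDirichletEnergy a w h < coreBottom w a + 1 / ((j : ℝ) + 1) := by
    intro j
    have hlt : sInf T < coreBottom w a + 1 / ((j : ℝ) + 1) := by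
      rw [← hT]; exact lt_add_of_pos_right _ (by positivity)
    obtain ⟨x, ⟨h, hh, hhs, hhn, rfl⟩, hx⟩ := exists_lt_of_csInf_lt hTne hlt
    exact ⟨h, hh, hhs, hhn, hx⟩
  choose h hh hhs hhn hhE using hstep
  have hj0 : Tendsto (fun j : ℕ ↦ 1 / ((j : ℝ) + 1)) atTop (𝓝 (0 : ℝ)) :=
    tendsto_one_div_add_atTop_nhds_zero_nat
  have hE : Tendsto (fun j ↦ tableDirichletEnergy a w (h j)) atTop (𝓝 (coreBottom w a)) := by
    have h0 : Tendsto (fun j : ℕ ↦ coreBottom w a + 1 / ((j : ℝ) + 1)) atTop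
        (𝓝 (coreBottom w a)) := by
      simpa using tendsto_const_nhds.add hj0
    exact tendsto_of_tendsto_of_tendsto_of_le_of_le tendsto_const_nhds h0
      (fun j ↦ coreBottom_le hw (coreAdm_of_isWeilTest (hh j) (hhs j)) (hhn j))
      (fun j ↦ (hhE j).le)
  -- file VIII: convergence modulo phases
  obtain ⟨c, hcn, hlim⟩ := hu.tendsto_of_minimizing hw ha (fun j ↦ ⟨hh j, hhs j, hhn j⟩) hE
  -- pick an index where both the energy excess and the distance are below `ε`
  have hev₁ : ∀ᶠ j : ℕ in atTop, 1 / ((j : ℝ) + 1) < ε := hj0.eventually (gt_mem_nhds hε)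
  have hev₂ : ∀ᶠ j : ℕ in atTop, ∫ x, ‖c j * h j x - u x‖ ^ 2 < ε :=
    hlim.eventually (gt_mem_nhds hε)
  obtain ⟨j, hj₁, hj₂⟩ := (hev₁.and hev₂).exists
  refine ⟨fun x ↦ c j * h j x, (hh j).const_mul (c j), tsupport_mul_subset_right.trans (hhs j),
    ?_, ?_, hj₂.le⟩
  · have e : (fun x ↦ ‖c j * h j x‖ ^ 2) = fun x ↦ ‖h j x‖ ^ 2 := by
      funext x; rw [norm_mul, hcn j, one_mul]
    rw [e, hhn j]
  · rw [tableDirichletEnergy_const_mul, hcn j, one_pow, one_mul]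
    linarith [hhE j]

/-! ## §2 Stability of the core ground state -/

/-- **The bottom is continuous along a convergent sequence of tables** (`tableDist a w_k w → 0`,
non-negative tables). [folklore] -/
theorem tendsto_coreBottom_of_tables (hw : ∀ n ∈ weilPrimeIndex a, 0 ≤ w n) {wk : ℕ → ℕ → ℝ}
    (hwk : ∀ k, ∀ n ∈ weilPrimeIndex a, 0 ≤ wk k n) (ha : 0 < a)
    (hd : Tendsto (fun k ↦ tableDist a (wk k) w) atTop (𝓝 0)) :
    Tendsto (fun k ↦ coreBottom (wk k) a) atTop (𝓝 (coreBottom w a)) := by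
  rw [tendsto_iff_norm_sub_tendsto_zero]
  refine squeeze_zero (fun _ ↦ norm_nonneg _)
    (fun k ↦ (Real.norm_eq_abs _).le.trans (abs_coreBottom_sub_le (hwk k) hw ha)) ?_
  simpa using hd.const_mul 4

/-- **STABILITY OF THE CORE GROUND STATE.**  Let `w_k, w` be non-negative tables on the prime index
of the window with `tableDist a w_k w → 0`, and let `u_k`, `u` be core ground states of `w_k`, `w` on
`[-a, a]`.  Then `u_k → u` in `L²` modulo unimodular constants.
[cite: Bombieri2000Weil, §4 Thm 3] -/
theorem IsCoreGround.tendsto_of_tables (hw : ∀ n ∈ weilPrimeIndex a, 0 ≤ w n) {wk : ℕ → ℕ → ℝ}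
    (hwk : ∀ k, ∀ n ∈ weilPrimeIndex a, 0 ≤ wk k n) (ha : 0 < a)
    (hd : Tendsto (fun k ↦ tableDist a (wk k) w) atTop (𝓝 0))
    {u : ℝ → ℂ} (hu : IsCoreGround w a u) {uk : ℕ → ℝ → ℂ}
    (huk : ∀ k, IsCoreGround (wk k) a (uk k)) :
    ∃ c : ℕ → ℂ, (∀ k, ‖c k‖ = 1) ∧
      Tendsto (fun k ↦ ∫ x, ‖c k * uk k x - u x‖ ^ 2) atTop (𝓝 0) := by
  classical
  -- test approximants of the moving ground states
  have hstep : ∀ k : ℕ, ∃ g : ℝ → ℂ, IsWeilTest g ∧ tsupport g ⊆ Icc (-a) a ∧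
      ∫ t, ‖g t‖ ^ 2 = (1 : ℝ) ∧
        tableDirichletEnergy a (wk k) g ≤ coreBottom (wk k) a + 1 / ((k : ℝ) + 1) ∧
          ∫ x, ‖g x - uk k x‖ ^ 2 ≤ 1 / ((k : ℝ) + 1) := fun k ↦
    (huk k).exists_isWeilTest_near (hwk k) ha (by positivity)
  choose G hG hGs hGn hGE hGd using hstep
  -- they form a minimising sequence for the limit table
  have hd' : ∀ k, tableDist a w (wk k) = tableDist a (wk k) w := fun k ↦ tableDist_comm _ _ _
  have hup : ∀ k, tableDirichletEnergy a w (G k) ≤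
      coreBottom w a + 8 * tableDist a (wk k) w + 1 / ((k : ℝ) + 1) := by
    intro k
    have h₁ := abs_tableDirichletEnergy_sub_le (hG k).memLp_two a w (wk k)
    rw [hGn k, mul_one, hd'] at h₁
    have h₂ := (abs_sub_le_iff.1 h₁).1
    have h₃ := (abs_sub_le_iff.1 (abs_coreBottom_sub_le (hwk k) hw ha)).1
    linarith [hGE k]
  have hk0 : Tendsto (fun k : ℕ ↦ 1 / ((k : ℝ) + 1)) atTop (𝓝 (0 : ℝ)) :=
    tendsto_one_div_add_atTop_nhds_zero_nat
  have hE : Tendsto (fun k ↦ tableDirichletEnergy a w (G k)) atTop (𝓝 (coreBottom w a)) := by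
    have h0 : Tendsto (fun k : ℕ ↦ coreBottom w a + 8 * tableDist a (wk k) w + 1 / ((k : ℝ) + 1))
        atTop (𝓝 (coreBottom w a)) := by
      simpa using (tendsto_const_nhds.add (hd.const_mul 8)).add hk0
    exact tendsto_of_tendsto_of_tendsto_of_le_of_le tendsto_const_nhds h0
      (fun k ↦ coreBottom_le hw (coreAdm_of_isWeilTest (hG k) (hGs k)) (hGn k)) hup
  -- file VIII for the limit table
  obtain ⟨c, hcn, hlim⟩ := hu.tendsto_of_minimizing hw ha (fun k ↦ ⟨hG k, hGs k, hGn k⟩) hE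
  refine ⟨c, hcn, ?_⟩
  -- transfer back to `u_k`
  have huL : MemLp u 2 := hu.1.1
  have hb : ∀ k, ∫ x, ‖c k * uk k x - u x‖ ^ 2 ≤
      2 * (1 / ((k : ℝ) + 1)) + 2 * ∫ x, ‖c k * G k x - u x‖ ^ 2 := by
    intro k
    have hA : MemLp (fun x ↦ c k * (uk k x - G k x)) 2 :=
      ((huk k).1.1.sub (hG k).memLp_two).const_mul (c k)
    have hB : MemLp (fun x ↦ c k * G k x - u x) 2 := ((hG k).memLp_two.const_mul (c k)).sub huL
    have h := integral_norm_sq_add_le hA hB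
    have e1 : (fun x ↦ ‖c k * (uk k x - G k x) + (c k * G k x - u x)‖ ^ 2) =
        fun x ↦ ‖c k * uk k x - u x‖ ^ 2 := by
      funext x; ring_nf
    have e2 : ∫ x, ‖c k * (uk k x - G k x)‖ ^ 2 = ∫ x, ‖G k x - uk k x‖ ^ 2 :=
      integral_congr_ae (Eventually.of_forall fun x ↦ by
        simp only [norm_mul, hcn k, one_mul, norm_sub_rev])
    rw [e1, e2] at h
    linarith [hGd k]
  have h0 : Tendsto (fun k : ℕ ↦ 2 * (1 / ((k : ℝ) + 1)) + 2 * ∫ x, ‖c k * G k x - u x‖ ^ 2)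
      atTop (𝓝 0) := by
    simpa using (hk0.const_mul 2).add (hlim.const_mul 2)
  exact squeeze_zero (fun k ↦ integral_nonneg fun _ ↦ by positivity) hb h0

/-- **Stability of the non-negative ground representative, no phases**: if in addition `u_k = Φ_k`,
`u = Φ` are REAL and a.e. NON-NEGATIVE (the positive even representatives of files IV/VII), then
`Φ_k → Φ` in `L²` outright — the unimodular constants are forced to `1`. [folklore] -/
theorem tendsto_of_tables_of_nonneg (hw : ∀ n ∈ weilPrimeIndex a, 0 ≤ w n) {wk : ℕ → ℕ → ℝ}
    (hwk : ∀ k, ∀ n ∈ weilPrimeIndex a, 0 ≤ wk k n) (ha : 0 < a)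
    (hd : Tendsto (fun k ↦ tableDist a (wk k) w) atTop (𝓝 0))
    {Φ : ℝ → ℝ} (hΦ : IsCoreGround w a fun x ↦ (Φ x : ℂ)) (hΦ₀ : ∀ᵐ x : ℝ, 0 ≤ Φ x)
    {Φk : ℕ → ℝ → ℝ} (hΦk : ∀ k, IsCoreGround (wk k) a fun x ↦ (Φk k x : ℂ))
    (hΦk₀ : ∀ k, ∀ᵐ x : ℝ, 0 ≤ Φk k x) :
    Tendsto (fun k ↦ ∫ x, ‖(Φk k x : ℂ) - (Φ x : ℂ)‖ ^ 2) atTop (𝓝 0) := by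
  classical
  obtain ⟨c, hcn, hlim⟩ := hΦ.tendsto_of_tables hw hwk ha hd hΦk
  have hΦL : MemLp (fun x ↦ (Φ x : ℂ)) 2 := hΦ.1.1
  have hΦn : ∫ x, ‖(Φ x : ℂ)‖ ^ 2 = 1 := hΦ.2.1
  have hΦkL : ∀ k, MemLp (fun x ↦ (Φk k x : ℂ)) 2 := fun k ↦ (hΦk k).1.1
  -- the overlaps `s_k = ∫ Φ_k Φ ≥ 0` and `c_k s_k → 1`
  set s : ℕ → ℂ := fun k ↦ ∫ x, (Φk k x : ℂ) * conj ((Φ x : ℂ)) with hsdef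
  have hs_real : ∀ k, s k = ((∫ x, Φk k x * Φ x : ℝ) : ℂ) := by
    intro k
    rw [hsdef]
    simp only [Complex.conj_ofReal, ← Complex.ofReal_mul]
    exact integral_complex_ofReal
  have hs_nonneg : ∀ k, 0 ≤ ∫ x, Φk k x * Φ x := fun k ↦
    integral_nonneg_of_ae (by
      filter_upwards [hΦ₀, hΦk₀ k] with x h1 h2
      exact mul_nonneg h2 h1)
  have hcs : Tendsto (fun k ↦ c k * s k) atTop (𝓝 1) := by
    have h := tendsto_integral_mul_conj_left hΦL hΦL (fun k ↦ (hΦkL k).const_mul (c k)) hlim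
    have e : ∫ x, (Φ x : ℂ) * conj ((Φ x : ℂ)) = 1 := by
      rw [integral_mul_conj_self, hΦn]; simp
    rw [e] at h
    refine h.congr fun k ↦ ?_
    rw [hsdef, ← integral_const_mul]
    exact integral_congr_ae (Eventually.of_forall fun x ↦ by simp only; ring)
  -- hence `s_k → 1` (as `‖c_k s_k‖ = s_k`) and `c_k → 1`
  have hs1 : Tendsto s atTop (𝓝 1) := by
    have h1 : Tendsto (fun k ↦ ((‖c k * s k‖ : ℝ) : ℂ)) atTop (𝓝 (((‖(1 : ℂ)‖ : ℝ)) : ℂ)) :=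
      ((Complex.continuous_ofReal.comp continuous_norm).tendsto _).comp hcs
    rw [norm_one, Complex.ofReal_one] at h1
    refine h1.congr fun k ↦ ?_
    simp only [norm_mul, hcn k, one_mul, hs_real k, Complex.norm_real,
      Real.norm_of_nonneg (hs_nonneg k)]
  have hc1 : Tendsto c atTop (𝓝 1) := by
    have hev : ∀ᶠ k in atTop, s k ≠ 0 := hs1.eventually_ne one_ne_zero
    have h := hcs.div hs1 one_ne_zero
    rw [div_one] at h
    refine h.congr' ?_
    filter_upwards [hev] with k hk
    exact mul_div_cancel_right₀ (c k) hk
  -- `∫|Φ_k − Φ|² ≤ 2|1 − c_k|² + 2∫|c_k Φ_k − Φ|²`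
  have hΦkn : ∀ k, ∫ x, ‖(Φk k x : ℂ)‖ ^ 2 = 1 := fun k ↦ (hΦk k).2.1
  have hb : ∀ k, ∫ x, ‖(Φk k x : ℂ) - (Φ x : ℂ)‖ ^ 2 ≤
      2 * ‖1 - c k‖ ^ 2 + 2 * ∫ x, ‖c k * (Φk k x : ℂ) - (Φ x : ℂ)‖ ^ 2 := by
    intro k
    have hA : MemLp (fun x ↦ (1 - c k) * (Φk k x : ℂ)) 2 := (hΦkL k).const_mul _
    have hB : MemLp (fun x ↦ c k * (Φk k x : ℂ) - (Φ x : ℂ)) 2 :=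
      ((hΦkL k).const_mul (c k)).sub hΦL
    have h := integral_norm_sq_add_le hA hB
    have e1 : (fun x ↦ ‖(1 - c k) * (Φk k x : ℂ) + (c k * (Φk k x : ℂ) - (Φ x : ℂ))‖ ^ 2) =
        fun x ↦ ‖(Φk k x : ℂ) - (Φ x : ℂ)‖ ^ 2 := by
      funext x; ring_nf
    have e2 : ∫ x, ‖(1 - c k) * (Φk k x : ℂ)‖ ^ 2 = ‖1 - c k‖ ^ 2 := by
      have : (fun x ↦ ‖(1 - c k) * (Φk k x : ℂ)‖ ^ 2) =
          fun x ↦ ‖1 - c k‖ ^ 2 * ‖(Φk k x : ℂ)‖ ^ 2 := by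
        funext x; rw [norm_mul, mul_pow]
      rw [this, integral_const_mul, hΦkn k, mul_one]
    rw [e1, e2] at h
    exact h
  have h0 : Tendsto (fun k ↦ 2 * ‖1 - c k‖ ^ 2 + 2 * ∫ x, ‖c k * (Φk k x : ℂ) - (Φ x : ℂ)‖ ^ 2)
      atTop (𝓝 0) := by
    have h1 : Tendsto (fun k ↦ ‖1 - c k‖ ^ 2) atTop (𝓝 0) := by
      have h : Tendsto (fun k ↦ (1 : ℂ) - c k) atTop (𝓝 (1 - 1)) := tendsto_const_nhds.sub hc1
      have h' := h.norm.pow 2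
      rw [sub_self, norm_zero, zero_pow two_ne_zero] at h'
      exact h'
    simpa using (h1.const_mul 2).add (hlim.const_mul 2)
  exact squeeze_zero (fun k ↦ integral_nonneg fun _ ↦ by positivity) hb h0

/-- **The positive even ground states of a convergent sequence of tables converge** (packaged with
the representatives of file IV): along `tableDist a w_k w → 0` the positive even core ground states
`Φ_{w_k}` (any choices) converge in `L²` to `Φ_w`. [folklore] -/
theorem tendsto_posRep_of_tables (hw : ∀ n ∈ weilPrimeIndex a, 0 ≤ w n) {wk : ℕ → ℕ → ℝ}
    (hwk : ∀ k, ∀ n ∈ weilPrimeIndex a, 0 ≤ wk k n) (ha : 0 < a)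
    (hd : Tendsto (fun k ↦ tableDist a (wk k) w) atTop (𝓝 0))
    {Φ : ℝ → ℝ} (hΦ : IsCoreGround w a fun x ↦ (Φ x : ℂ)) (hΦpos : ∀ x ∈ Ioo (-a) a, 0 < Φ x)
    (hΦs : ∀ x, x ∉ Icc (-a) a → Φ x = 0)
    {Φk : ℕ → ℝ → ℝ} (hΦk : ∀ k, IsCoreGround (wk k) a fun x ↦ (Φk k x : ℂ))
    (hΦkpos : ∀ k, ∀ x ∈ Ioo (-a) a, 0 < Φk k x) (hΦks : ∀ k x, x ∉ Icc (-a) a → Φk k x = 0) :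
    Tendsto (fun k ↦ ∫ x, ‖(Φk k x : ℂ) - (Φ x : ℂ)‖ ^ 2) atTop (𝓝 0) := by
  -- positivity on `(-a, a)` and vanishing off `[-a, a]` give a.e. non-negativity (the two boundary
  -- points are null)
  have hnull : ∀ᵐ x : ℝ, x ≠ -a ∧ x ≠ a := by
    have h1 : ∀ᵐ x : ℝ, x ≠ -a := by simp [ae_iff]
    have h2 : ∀ᵐ x : ℝ, x ≠ a := by simp [ae_iff]
    exact h1.and h2
  have key : ∀ {Ψ : ℝ → ℝ}, (∀ x ∈ Ioo (-a) a, 0 < Ψ x) → (∀ x, x ∉ Icc (-a) a → Ψ x = 0) →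
      ∀ᵐ x : ℝ, 0 ≤ Ψ x := by
    intro Ψ hp hs
    filter_upwards [hnull] with x hx
    by_cases h : x ∈ Ioo (-a) a
    · exact (hp x h).le
    · have : x ∉ Icc (-a) a := fun h' ↦
        h ⟨lt_of_le_of_ne h'.1 (Ne.symm hx.1), lt_of_le_of_ne h'.2 hx.2⟩
      rw [hs x this]
  exact tendsto_of_tables_of_nonneg hw hwk ha hd hΦ (key hΦpos hΦs) hΦk fun k ↦
    key (hΦkpos k) (hΦks k)

end Summit.RiemannHypothesis.RiemannHypothesis.Theorems.PfPersistence

end
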